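import Summits.ResolutionOfSingularities.KangarooAtlas.MizutaniOperatorNormalForm
import Summits.ResolutionOfSingularities.KangarooAtlas.MizutaniOperatorAnnihilator
import Literature.RingTheory.MvPolynomial.RuppertMatrix
import Mathlib.Data.Nat.Prime.Factorial
import HarnessLib

/-!
# Mizutani's Lemma 2.9 (1): `dim_L ker D ≤ 2p` for a second-order differential operator on a two-generator tower

Cell topic `Summits/ResolutionOfSingularities/KangarooAtlas` (pub-rosobs); namespace
`Summit.ResolutionOfSingularities.KangarooAtlas.Mizutani`.  H. Mizutani, Nagoya Math. J. 52 (1973), Lemma 2.9 (p. 92):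
«Let `k ⊃ K ⊃ k^p` with `[K : k^p] = p²` and `p ≠ 2`, and let `D` be an element of `Diff_2(K/k^p)` with `D ≠ 0` and
`D(1) = 0`.  Then (1) `dim_{k^p} ker(D) ≤ 2p`» — the step of Thm. 2.8 (second part) that encloser-2's
`MizutaniExtremal.lean` records as NOT PROVED.  This file proves THE COUNT in the tree's tower language, in the normalised
situation of Mizutani's proof (p. 93: a `p`-basis `t₁, t₂` chosen INSIDE `ker D`, so that `D = a D_1D_2 + b D_1^2 + c D_2^2`):

* **`IsRootTower.finrank_ker_le_two_mul`** — for a root tower `h : IsRootTower L K p x a` with TWO generators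
  (`a : Fin 2 → K`, `[K : L] = p²`) and an `L`-linear `D : K → K` of order `≤ 2` with `D ≠ 0`, `D 1 = 0`, `D a₀ = D a₁ = 0`:
  `finrank L (ker D) ≤ 2p`.

Mizutani's argument, as formalised: by `MizutaniOperatorOrder.lean` `D = Σ_{|W|=2} c_W D^{(W)}`; let `T₀` be the index with
`c_{T₀} ≠ 0` and largest second coordinate.  For every `S` with `S + T₀` in the box `[0,p)²` the operator `D^{(S)} ∘ D` kills
`ker D` and equals `c_{T₀} C(S+T₀,T₀) · D^{(S+T₀)}` modulo the `K`-span of the `D^{(U)}` with smaller key `(|U|, U₁)`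
(`IsRootTower.hsD_comp_sub_mem_lowSpan`; composition rule and Leibniz from `MizutaniOperatorBasis.lean`; `C(S+T₀,T₀) ≠ 0` in
characteristic `p` because all entries are `< p`).  A family with distinct leading terms over a basis is linearly independent
(`linearIndependent_of_leading`, `MizutaniOperatorAnnihilator.lean`), so these `(p − T₀,₀)(p − T₀,₁) ≥ p(p−2)` operators span as many dimensions inside the
annihilator `{Φ ∈ End_L K : Φ(ker D) = 0}`, whose `K`-dimension is `p² − dim_L ker D` (`finrank_annihilator_add`, `MizutaniOperatorAnnihilator.lean`: restriction
to `ker D` is surjective onto `Hom_L(ker D, K)`, of `K`-dimension `dim_L ker D`).  Hence `p(p−2) ≤ p² − dim_L ker D`.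
(Mizutani: «`I = Diff·D` … `dim_K I ≥ p(p−2)` … `p² − n = dim_K Hom(K/T,K) ≥ dim_K I`».)

NOT in this file: the reduction of the general statement (`ker D` contains a `p`-basis or lies in a proper subfield) and
part (2) of the lemma (the equality case, whose proof Mizutani only outlines).

References: [Mizutani1973HironakaGroupSchemes] Lemma 2.9 and its proof (p. 92–94).
-/

noncomputable section

open MvPolynomial Literature.AlgebraicGeometry.Resolution
open Literature.RingTheory.MvPolynomial.Ruppert (degree_fin_two)

namespace Summit.ResolutionOfSingularities.KangarooAtlas.Mizutani

universe u

/-! ### The count on a two-generator tower -/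

section Count

variable {L K : Type u} [Field L] [Field K] [Algebra L K] {p : ℕ} [hp : Fact p.Prime] [CharP K p]
  {x : Fin 2 → L} {a : Fin 2 → K}

variable (p) in
/-- The KEY `κ(U) = p·|U| + U₁` (lexicographic order by total degree, then by the second coordinate; injective on the box).
[cite: Mizutani1973HironakaGroupSchemes, Lemma 2.9 (proof: the leading entries of the matrices ρ(Δ_{ij} D))] -/
def key (U : Fin 2 →₀ ℕ) : ℕ := p ^ 1 * U.degree + U 1

omit hp in
/-- Lower degree gives lower key (for `U` in the box). [folklore] -/
theorem key_lt_key_of_degree_lt {U V : Fin 2 →₀ ℕ} (hU : InBox (p ^ 1) U) (h : U.degree < V.degree) :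
    key p U < key p V := by
  unfold key
  have h1 : U 1 < p ^ 1 := hU 1
  nlinarith

omit hp in
/-- Equal degree and smaller second coordinate gives lower key. [folklore] -/
theorem key_lt_key_of_degree_eq {U V : Fin 2 →₀ ℕ} (h : U.degree = V.degree) (h1 : U 1 < V 1) :
    key p U < key p V := by
  unfold key; rw [h]; omega

/-- The key is injective on the box. [folklore] -/
theorem key_injective_of_inBox {U V : Fin 2 →₀ ℕ} (hU : InBox (p ^ 1) U) (hV : InBox (p ^ 1) V)
    (h : key p U = key p V) : U = V := by
  unfold key at h
  have hU1 : U 1 < p ^ 1 := hU 1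
  have hV1 : V 1 < p ^ 1 := hV 1
  have hmod : U 1 = V 1 := by
    have := congrArg (· % p ^ 1) h
    rwa [Nat.add_comm, Nat.add_mul_mod_self_left, Nat.add_comm, Nat.add_mul_mod_self_left, Nat.mod_eq_of_lt hU1,
      Nat.mod_eq_of_lt hV1] at this
  have hq : 0 < p ^ 1 := pow_pos hp.out.pos 1
  have hdeg : U.degree = V.degree := Nat.eq_of_mul_eq_mul_left hq (by omega)
  rw [degree_fin_two, degree_fin_two, hmod] at hdeg
  ext i
  fin_cases i
  · simpa using hdeg
  · exact hmod

/-- The box tuple of a box exponent vector. [folklore] -/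
def toTuple (U : Fin 2 →₀ ℕ) (hU : InBox (p ^ 1) U) : Fin 2 → Fin (p ^ 1) := fun i => ⟨U i, hU i⟩

omit hp in
/-- `finsuppOf (toTuple U) = U`. [folklore] -/
@[simp] theorem finsuppOf_toTuple (U : Fin 2 →₀ ℕ) (hU : InBox (p ^ 1) U) : finsuppOf (toTuple U hU) = U := by
  ext i; simp [toTuple, finsuppOf_apply]

omit hp in
/-- `finsuppOf` is injective. [folklore] -/
theorem finsuppOf_injective : Function.Injective (finsuppOf : (Fin 2 → Fin (p ^ 1)) → Fin 2 →₀ ℕ) := by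
  intro W W' h
  funext i
  apply Fin.ext
  have hi := congrArg (fun M : Fin 2 →₀ ℕ => M i) h
  simpa [finsuppOf_apply] using hi

/-- The key on box tuples is injective. [folklore] -/
theorem key_finsuppOf_injective : Function.Injective fun W : Fin 2 → Fin (p ^ 1) => key p (finsuppOf W) :=
  fun W W' h => finsuppOf_injective (key_injective_of_inBox (inBox_finsuppOf W) (inBox_finsuppOf W') h)

/-- The span of the operators `D^{(U)}` with `κ(U) < k` («lower terms»). [cite: Mizutani1973HironakaGroupSchemes, Lemma 2.9 (proof)] -/
def lowSpan (h : IsRootTower L K (p ^ 1) x a) (k : ℕ) : Submodule K (K →ₗ[L] K) :=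
  Submodule.span K {Φ | ∃ U : Fin 2 →₀ ℕ, key p U < k ∧ Φ = h.hsD U}

/-- `D^{(U)} = 0` (as a map) outside the box. [folklore] -/
theorem IsRootTower.hsD_eq_zero_of_not_inBox' (h : IsRootTower L K (p ^ 1) x a) {U : Fin 2 →₀ ℕ}
    (hU : ¬ InBox (p ^ 1) U) : h.hsD U = 0 :=
  LinearMap.ext fun y => h.hsD_eq_zero_of_not_inBox hU y

/-- Composition with a finite sum of linear maps. [folklore] -/
theorem comp_finset_sum {ι : Type*} (s : Finset ι) (f : K →ₗ[L] K) (g : ι → K →ₗ[L] K) :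
    f ∘ₗ (∑ i ∈ s, g i) = ∑ i ∈ s, f ∘ₗ g i := by
  classical
  induction s using Finset.induction_on with
  | empty => simp
  | insert i s hi ih => rw [Finset.sum_insert hi, Finset.sum_insert hi, LinearMap.comp_add, ih]

/-- `D^{(U)}` lies in every lower span above its key (and is `0` off the box). [folklore] -/
theorem IsRootTower.hsD_mem_lowSpan (h : IsRootTower L K (p ^ 1) x a) {U : Fin 2 →₀ ℕ} {k : ℕ}
    (hU : ¬ InBox (p ^ 1) U ∨ key p U < k) : h.hsD U ∈ lowSpan h k := by
  by_cases hb : InBox (p ^ 1) U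
  · exact Submodule.subset_span ⟨U, hU.resolve_left (not_not.mpr hb), rfl⟩
  · rw [h.hsD_eq_zero_of_not_inBox' hb]; exact Submodule.zero_mem _

/-- The lower span below `k` lies in the span of the basis vectors of key `< k`. [folklore] -/
theorem lowSpan_le_span_image (h : IsRootTower L K (p ^ 1) x a) (k : ℕ) :
    lowSpan h k ≤ Submodule.span K (h.hsDBasis '' {W | key p (finsuppOf W) < k}) := by
  refine Submodule.span_le.mpr ?_
  rintro _ ⟨U, hU, rfl⟩
  by_cases hUb : InBox (p ^ 1) U
  · refine Submodule.subset_span ⟨toTuple U hUb, ?_, ?_⟩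
    · show key p (finsuppOf (toTuple U hUb)) < k
      rwa [finsuppOf_toTuple]
    · rw [h.hsDBasis_apply, finsuppOf_toTuple]
  · rw [h.hsD_eq_zero_of_not_inBox' hUb]
    exact Submodule.zero_mem _

/-! #### Operator Leibniz and the leading term of `D^{(S)} ∘ D` -/

/-- Operator Leibniz: `D^{(S)} ∘ (c · D^{(T)}) = Σ_{S₁+S₂=S} (D^{(S₁)} c · C(S₂+T,T)) · D^{(S₂+T)}` (`S` in the box).
[cite: EGAIV4, Thm. 16.11.2 ((16.11.2.2) and the Leibniz rule); Mizutani1973HironakaGroupSchemes, Lemma 2.9 (proof)] -/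
theorem IsRootTower.hsD_comp_smul_hsD (h : IsRootTower L K (p ^ 1) x a) {S : Fin 2 →₀ ℕ} (hS : InBox (p ^ 1) S)
    (c : K) (T : Fin 2 →₀ ℕ) :
    h.hsD S ∘ₗ (c • h.hsD T) =
      ∑ w ∈ Finset.HasAntidiagonal.antidiagonal S,
        (h.hsD w.1 c * (mchoose (w.2 + T) T : K)) • h.hsD (w.2 + T) := by
  ext y
  rw [LinearMap.comp_apply, LinearMap.smul_apply, smul_eq_mul, h.hsD_mul hS, LinearMap.sum_apply]
  refine Finset.sum_congr rfl fun w _ => ?_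
  rw [LinearMap.smul_apply, smul_eq_mul, h.hsD_hsD, mul_assoc]

omit hp in
/-- On the punctured antidiagonal the second component is strictly below `S`. [folklore] -/
theorem snd_lt_of_mem_erase_antidiagonal {S : Fin 2 →₀ ℕ} {w : (Fin 2 →₀ ℕ) × (Fin 2 →₀ ℕ)}
    (hw : w ∈ (Finset.HasAntidiagonal.antidiagonal S).erase (0, S)) : w.2 ≤ S ∧ w.2 ≠ S := by
  classical
  have hw' : w.1 + w.2 = S := Finset.HasAntidiagonal.mem_antidiagonal.mp (Finset.mem_of_mem_erase hw)
  refine ⟨by rw [← hw']; exact le_add_self, fun h2 => Finset.ne_of_mem_erase hw ?_⟩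
  have h1 : w.1 = 0 := by
    ext i
    have := DFunLike.congr_fun hw' i
    rw [Finsupp.add_apply, h2] at this
    simp only [Finsupp.coe_zero, Pi.zero_apply]
    omega
  exact Prod.ext h1 h2

/-- **Leading term**: if `D = Σ_{W ∈ F} c_W D^{(W)}` over indices `W` of degree `2` with all `c_W ≠ 0`, and `W₀ ∈ F` has the
largest second coordinate, then for every `S` in the box `D^{(S)} ∘ D − (c_{W₀} C(S+W₀,W₀)) · D^{(S+W₀)}` lies in the span of
the `D^{(U)}` with `κ(U) < κ(S+W₀)`. [cite: Mizutani1973HironakaGroupSchemes, Lemma 2.9 (proof: the products Δ_{ij}·D have distinct leading terms)] -/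
theorem IsRootTower.hsD_comp_sub_mem_lowSpan (h : IsRootTower L K (p ^ 1) x a) (F : Finset (Fin 2 → Fin (p ^ 1)))
    (hF : ∀ W ∈ F, (finsuppOf W).degree = 2) (c : (Fin 2 → Fin (p ^ 1)) → K) (W₀ : Fin 2 → Fin (p ^ 1)) (hW₀ : W₀ ∈ F)
    (hmax : ∀ W ∈ F, (finsuppOf W) 1 ≤ (finsuppOf W₀) 1) {S : Fin 2 →₀ ℕ} (hS : InBox (p ^ 1) S) :
    h.hsD S ∘ₗ (∑ W ∈ F, c W • h.hsD (finsuppOf W)) -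
        (c W₀ * (mchoose (S + finsuppOf W₀) (finsuppOf W₀) : K)) • h.hsD (S + finsuppOf W₀) ∈
      lowSpan h (key p (S + finsuppOf W₀)) := by
  classical
  have h0S : ((0 : Fin 2 →₀ ℕ), S) ∈ Finset.HasAntidiagonal.antidiagonal S := by simp
  -- expand `D^{(S)} ∘ D` by operator Leibniz and split off the term `(W₀, (0, S))`
  rw [comp_finset_sum, Finset.sum_congr rfl fun W _ => h.hsD_comp_smul_hsD hS (c W) (finsuppOf W),
    ← Finset.add_sum_erase _ _ hW₀, ← Finset.add_sum_erase _ _ h0S]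
  simp only [h.hsD_zero_apply]
  rw [add_assoc, add_sub_cancel_left]
  -- every remaining term is a lower term
  refine Submodule.add_mem _ (Submodule.sum_mem _ fun w hw => Submodule.smul_mem _ _ ?_)
    (Submodule.sum_mem _ fun W hW => Submodule.sum_mem _ fun w hw => Submodule.smul_mem _ _ ?_)
  · -- `W = W₀`, `w ≠ (0, S)`: strictly smaller degree
    obtain ⟨hle, hne⟩ := snd_lt_of_mem_erase_antidiagonal hw
    refine h.hsD_mem_lowSpan (or_iff_not_imp_left.mpr fun hbox => key_lt_key_of_degree_lt (not_not.mp hbox) ?_)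
    rw [map_add, map_add]
    have := degree_lt_of_lt hle hne
    omega
  · -- `W ≠ W₀`: smaller second coordinate (both of degree `2`)
    have hWF : W ∈ F := Finset.mem_of_mem_erase hW
    have hWne : W ≠ W₀ := Finset.ne_of_mem_erase hW
    have hw' : w.1 + w.2 = S := Finset.HasAntidiagonal.mem_antidiagonal.mp hw
    have hle : w.2 ≤ S := by rw [← hw']; exact le_add_self
    have h1lt : (finsuppOf W) 1 < (finsuppOf W₀) 1 := by
      refine lt_of_le_of_ne (hmax W hWF) fun heq => hWne (finsuppOf_injective ?_)
      -- two degree-2 indices with the same second coordinate coincide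
      have hd := hF W hWF
      have hd₀ := hF W₀ hW₀
      rw [degree_fin_two] at hd hd₀
      ext i
      fin_cases i
      · show (finsuppOf W) 0 = (finsuppOf W₀) 0
        omega
      · exact heq
    refine h.hsD_mem_lowSpan (or_iff_not_imp_left.mpr fun hbox => ?_)
    rcases lt_or_eq_of_le hle with hlt | heq
    · refine key_lt_key_of_degree_lt (not_not.mp hbox) ?_
      rw [map_add, map_add, hF W hWF, hF W₀ hW₀]
      have := degree_lt_of_lt hlt.le (ne_of_lt hlt)
      omega
    · rw [heq]
      refine key_lt_key_of_degree_eq ?_ ?_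
      · rw [map_add, map_add, hF W hWF, hF W₀ hW₀]
      · rw [Finsupp.add_apply, Finsupp.add_apply]; omega

/-! #### Nonvanishing of the leading binomial in characteristic `p` -/

/-- `p ∤ C(n, k)` for `k ≤ n < p`. [folklore] -/
theorem not_dvd_choose_of_lt {n k : ℕ} (hkn : k ≤ n) (hn : n < p) : ¬ p ∣ n.choose k := by
  intro hdvd
  have h1 : p ∣ n.factorial := hdvd.trans ⟨k.factorial * (n - k).factorial, by
    rw [← mul_assoc, Nat.choose_mul_factorial_mul_factorial hkn]⟩
  exact absurd ((Nat.Prime.dvd_factorial hp.out).mp h1) (not_le.mpr hn)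

/-- The leading binomial `C(U, T)` is a unit of `K` when `T ≤ U` and `U` lies in the box `[0,p)²`. [folklore] -/
theorem mchoose_cast_ne_zero {U T : Fin 2 →₀ ℕ} (hU : InBox (p ^ 1) U) (hTU : T ≤ U) :
    (mchoose U T : K) ≠ 0 := by
  rw [Ne, CharP.cast_eq_zero_iff K p, mchoose_eq_prod, Fin.prod_univ_two]
  intro hdvd
  rcases (Nat.Prime.dvd_mul hp.out).mp hdvd with h0 | h1
  · exact not_dvd_choose_of_lt (hTU 0) (by simpa using hU 0) h0
  · exact not_dvd_choose_of_lt (hTU 1) (by simpa using hU 1) h1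


omit hp in
/-- A two-index vector is in the box iff both coordinates are. [folklore] -/
theorem inBox_fin_two {q : ℕ} {U : Fin 2 →₀ ℕ} (h0 : U 0 < q) (h1 : U 1 < q) : InBox q U := by
  intro i
  fin_cases i
  · exact h0
  · exact h1

omit hp in
/-- The final arithmetic: `(p − A)(p − B) ≤ M`, `M + n = p²`, `A + B = 2` force `n ≤ 2p`. [folklore] -/
theorem le_two_mul_of_count {p n M A B : ℕ} (hp2 : 2 ≤ p) (hAB : A + B = 2) (hcard : (p - A) * (p - B) ≤ M)
    (hann : M + n = p ^ 2) : n ≤ 2 * p := by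
  obtain ⟨q, rfl⟩ : ∃ q, p = q + 2 := ⟨p - 2, by omega⟩
  have hkey : (q + 2) * q ≤ (q + 2 - A) * (q + 2 - B) := by
    rcases Nat.eq_zero_or_pos A with hA | hA
    · subst hA
      have hB : B = 2 := by omega
      subst hB
      simp
    · rcases Nat.eq_zero_or_pos B with hB | hB
      · subst hB
        have hA' : A = 2 := by omega
        subst hA'
        rw [Nat.sub_zero, Nat.add_sub_cancel, mul_comm]
      · have hA' : A = 1 := by omega
        have hB' : B = 1 := by omega
        subst hA' hB'
        rw [show q + 2 - 1 = q + 1 by omega]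
        nlinarith
  nlinarith [hkey, hcard, hann]

/-! #### Mizutani's Lemma 2.9 (1) on the tower -/

/-- **MIZUTANI'S LEMMA 2.9 (1), tower form.**  `L ⊆ K` fields of characteristic `p`, `h : IsRootTower L K p x a` a root tower
with two generators `a₀, a₁` (`a_i^p ∈ L`, `[K : L] = p²`), `D : K → K` an `L`-linear differential operator of order `≤ 2`
with `D ≠ 0`, `D 1 = 0` and `D a₀ = D a₁ = 0` (the `p`-basis lies in `ker D` — Mizutani's normalisation `t₁, t₂ ∈ T`).  Then
`dim_L ker D ≤ 2p`. [cite: Mizutani1973HironakaGroupSchemes, Lemma 2.9 (1) (p. 92) and its proof (p. 93–94)] -/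
theorem IsRootTower.finrank_ker_le_two_mul (h : IsRootTower L K (p ^ 1) x a) (D : K →ₗ[L] K)
    (hD : IsDiffOpLE L 2 D) (hD0 : D ≠ 0) (h1 : D 1 = 0) (ha : ∀ i, D (a i) = 0) :
    Module.finrank L (LinearMap.ker D) ≤ 2 * p := by
  classical
  haveI := h.finiteDimensional
  set c : (Fin 2 → Fin (p ^ 1)) → K := fun W => h.hsDBasis.repr D W with hc
  -- the normal form `D = Σ_{|W| = 2, c_W ≠ 0} c_W D^{(W)}`
  set F : Finset (Fin 2 → Fin (p ^ 1)) :=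
    Finset.univ.filter fun W => (finsuppOf W).degree = 2 ∧ c W ≠ 0 with hFdef
  have hF : ∀ W ∈ F, (finsuppOf W).degree = 2 := fun W hW => (Finset.mem_filter.mp hW).2.1
  have hFc : ∀ W ∈ F, c W ≠ 0 := fun W hW => (Finset.mem_filter.mp hW).2.2
  have hDsum : D = ∑ W ∈ F, c W • h.hsD (finsuppOf W) := by
    conv_lhs => rw [h.eq_sum_degree_two_of_isDiffOpLE_two hD h1 ha]
    rw [hFdef, ← Finset.filter_filter]
    symm
    apply Finset.sum_filter_of_ne
    intro W _ hne h0
    exact hne (by rw [h0, zero_smul])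
  -- `F` is non-empty since `D ≠ 0`; take `W₀` with the largest second coordinate
  have hFne : F.Nonempty := by
    by_contra hF0
    rw [Finset.not_nonempty_iff_eq_empty] at hF0
    rw [hF0, Finset.sum_empty] at hDsum
    exact hD0 hDsum
  obtain ⟨W₀, hW₀, hmax⟩ := Finset.exists_max_image F (fun W => (finsuppOf W) 1) hFne
  set T₀ : Fin 2 →₀ ℕ := finsuppOf W₀ with hT₀
  have hT₀deg : T₀ 0 + T₀ 1 = 2 := by rw [← degree_fin_two]; exact hF W₀ hW₀
  -- the family `Φ_{uv} = D^{(S_{uv})} ∘ D`, `S_{uv} = (u, v)` with `S + T₀` in the box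
  have hu : ∀ u : Fin (p ^ 1 - T₀ 0), (u : ℕ) + T₀ 0 < p ^ 1 := fun u => by have := u.2; omega
  have hv : ∀ v : Fin (p ^ 1 - T₀ 1), (v : ℕ) + T₀ 1 < p ^ 1 := fun v => by have := v.2; omega
  let Sv : Fin (p ^ 1 - T₀ 0) × Fin (p ^ 1 - T₀ 1) → Fin 2 →₀ ℕ := fun uv =>
    Finsupp.single 0 (uv.1 : ℕ) + Finsupp.single 1 (uv.2 : ℕ)
  have hSv0 : ∀ uv, Sv uv 0 = uv.1 := fun uv => by
    simp only [Sv, Finsupp.add_apply, Finsupp.single_eq_same, Finsupp.single_eq_of_ne (show (0 : Fin 2) ≠ 1 by decide),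
      add_zero]
  have hSv1 : ∀ uv, Sv uv 1 = uv.2 := fun uv => by
    simp only [Sv, Finsupp.add_apply, Finsupp.single_eq_same, Finsupp.single_eq_of_ne (show (1 : Fin 2) ≠ 0 by decide),
      zero_add]
  have hSvbox : ∀ uv, InBox (p ^ 1) (Sv uv) := fun uv =>
    inBox_fin_two (by rw [hSv0]; have := hu uv.1; omega) (by rw [hSv1]; have := hv uv.2; omega)
  have hSTbox : ∀ uv, InBox (p ^ 1) (Sv uv + T₀) := fun uv =>
    inBox_fin_two (by rw [Finsupp.add_apply, hSv0]; exact hu uv.1) (by rw [Finsupp.add_apply, hSv1]; exact hv uv.2)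
  let Φ : Fin (p ^ 1 - T₀ 0) × Fin (p ^ 1 - T₀ 1) → (K →ₗ[L] K) := fun uv => h.hsD (Sv uv) ∘ₗ D
  -- linear independence by leading terms
  have hΦind : LinearIndependent K Φ := by
    refine linearIndependent_of_leading h.hsDBasis (fun W => key p (finsuppOf W)) key_finsuppOf_injective Φ
      (fun uv => toTuple (Sv uv + T₀) (hSTbox uv)) ?_ (fun uv => c W₀ * (mchoose (Sv uv + T₀) T₀ : K)) ?_ ?_
    · intro uv uv' heq
      have h' : Sv uv + T₀ = Sv uv' + T₀ := by
        have := congrArg finsuppOf heq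
        rwa [finsuppOf_toTuple, finsuppOf_toTuple] at this
      have h'' : Sv uv = Sv uv' := add_right_cancel h'
      have e0 := congrArg (fun M : Fin 2 →₀ ℕ => M 0) h''
      have e1 := congrArg (fun M : Fin 2 →₀ ℕ => M 1) h''
      simp only [hSv0, hSv1] at e0 e1
      exact Prod.ext (Fin.ext e0) (Fin.ext e1)
    · intro uv
      exact mul_ne_zero (hFc W₀ hW₀) (mchoose_cast_ne_zero (hSTbox uv) le_add_self)
    · intro uv
      show h.hsD (Sv uv) ∘ₗ D - (c W₀ * (mchoose (Sv uv + T₀) T₀ : K)) • h.hsDBasis (toTuple (Sv uv + T₀) (hSTbox uv)) ∈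
        Submodule.span K (h.hsDBasis '' {W | key p (finsuppOf W) < key p (finsuppOf (toTuple (Sv uv + T₀) (hSTbox uv)))})
      rw [h.hsDBasis_apply, finsuppOf_toTuple]
      refine lowSpan_le_span_image h (key p (Sv uv + T₀)) ?_
      have := h.hsD_comp_sub_mem_lowSpan F hF c W₀ hW₀ hmax (hSvbox uv)
      rwa [← hDsum] at this
  -- the family kills `ker D`
  have hΦann : Submodule.span K (Set.range Φ) ≤ annihilator L K (LinearMap.ker D) := by
    refine Submodule.span_le.mpr ?_
    rintro _ ⟨uv, rfl⟩ y hy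
    show h.hsD (Sv uv) (D y) = 0
    rw [LinearMap.mem_ker.mp hy, map_zero]
  -- count: `(p − T₀ 0)(p − T₀ 1) ≤ dim_K ann = p² − dim_L ker D`
  have hcard := Submodule.finrank_mono hΦann
  rw [finrank_span_eq_card hΦind, Fintype.card_prod, Fintype.card_fin, Fintype.card_fin] at hcard
  have hann := finrank_annihilator_add (L := L) (K := K) (LinearMap.ker D)
  rw [h.finrank_end] at hann
  rw [pow_one] at hcard hann
  exact le_two_mul_of_count hp.out.two_le hT₀deg hcard hann

end Count

end Summit.ResolutionOfSingularities.KangarooAtlas.Mizutani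

end
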